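import Mathlib.RingTheory.Valuation.ValuationSubring
import Mathlib.RingTheory.Valuation.ValuationRing
import Mathlib.RingTheory.PrincipalIdealDomain
import Mathlib.RingTheory.Nilpotent.Lemmas
import Mathlib.RingTheory.Noetherian.Basic
import Mathlib.RingTheory.Finiteness.Ideal
import HarnessLib

/-!
# No Noetherian slicing base for a valuation ring with non-principal maximal ideal
# (crux `IndSmooth.ValuativeSmoothing`, line `birth`, lead cycle 2 — a structural negative)

Crux stmt-ResolutionOfSingularities-16087 asks that valuation rings `O` of function fields over
a perfect field `k` be ind-smooth over `k`. The route's stated mechanism is General Néron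
Desingularization (Popescu; Stacks 07GC), whose engine away from the field case is the base
induction of Stacks 07F5 (PROVED in the tree, `Stacks07F5_reduceToField_holds`, from 07CM, 07CP,
07CR/07CT, 07F4): smooth factorisations for `R → Λ` are assembled from those of the slices
`R/I → Λ/IΛ` (`I ≠ 0`) and of the generic localisation. A slice `R₀/𝔫 → O/𝔫O` over a reduced
ring can only have smooth factorisations if `O/𝔫O` is REDUCED (smooth algebras over reduced
rings are reduced, and filtered colimits of reduced rings are reduced).

This file PROVES that for a valuation ring `O` whose maximal ideal is NOT principal — i.e. whose
value group has no least positive element, `𝔪 = 𝔪²`; every rank-one non-discrete `O`, the heart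
of the open core of the crux — there is no such base at all:

* `span_singleton_eq_maximalIdeal_of_isRadical` — in a valuation ring a non-zero proper principal
  RADICAL ideal is the maximal ideal;
* `eq_maximalIdeal_of_fg_of_isRadical` — the same for a finitely generated radical ideal (valuation
  rings are Bézout), which is then principal;
* `not_isReduced_quotient_map_of_not_isPrincipal` — **no Noetherian slicing**: if `𝔪_O` is not
  principal, then for EVERY ring map `f : R₀ → O` from a Noetherian ring and every ideal `J ⊆ R₀`
  with `0 ≠ J·O ≠ O`, the special fibre `O ⧸ J·O` is NOT reduced;
* `ValuationSubring.not_isReduced_quotient_of_noetherian_base` — the same for a valuation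
  subring of a field (the shape of the crux).

So Popescu's base induction cannot be pointed at such an `O` over any Noetherian base: either the
base reaches the closed point (`J·O ≠ 0` for `J` the contraction of `𝔪_O`) and the special fibre is
non-reduced, or it sees `O` only through the subfield `Frac(R₀/𝔫) ⊆ O` (algebraic over `k` when
`O` is zero-dimensional). When `𝔪_O = aO` IS principal (discrete top jump of the value group) the
slice `O/aO = κ(O)` is a field and slicing over `k[a]` is consistent; that case trades one rank of
`O` for the imperfect base `k(a)` and is not treated here. [folklore]
-/

-- single-problem summit: the doubled namespace component is forced
set_option linter.dupNamespace false

namespace Summit.ResolutionOfSingularities.ResolutionOfSingularities.Theorems.ValuativeSmoothing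

open IsLocalRing

section ValuationRing

variable {A : Type*} [CommRing A] [IsDomain A] [ValuationRing A]

/-- **In a valuation ring, a non-zero proper principal radical ideal is the maximal ideal.**
If `x ∈ 𝔪` is not a multiple of `a`, then `a = xc` with `c ∈ 𝔪`; comparing `x` and `c`:
`x = cd` gives `x² = a d ∈ (a)`, so `x ∈ (a)` by radicality; `c = xd` gives `c² = a d ∈ (a)`, so
`c ∈ (a)`, `c = ea`, `a = xea`, and `x` is a unit — contradiction. [folklore] -/
theorem span_singleton_eq_maximalIdeal_of_isRadical (a : A) (ha : a ≠ 0) (hu : ¬ IsUnit a)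
    (hrad : (Ideal.span ({a} : Set A)).IsRadical) :
    Ideal.span ({a} : Set A) = maximalIdeal A := by
  refine le_antisymm (IsLocalRing.le_maximalIdeal (by rwa [Ne, Ideal.span_singleton_eq_top])) ?_
  intro x hx
  have hxu : ¬ IsUnit x := (IsLocalRing.mem_maximalIdeal x).mp hx
  -- `x ∈ (a)` from `x ^ 2 ∈ (a)`, by radicality
  have hsq : ∀ y : A, y * y ∈ Ideal.span ({a} : Set A) → y ∈ Ideal.span ({a} : Set A) :=
    fun y hy => hrad ⟨2, by rwa [pow_two]⟩
  obtain ⟨c, hc | hc⟩ := ValuationRing.cond a x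
  · -- `a * c = x`
    exact Ideal.mem_span_singleton'.mpr ⟨c, by rw [mul_comm, hc]⟩
  · -- `x * c = a`
    by_cases hcu : IsUnit c
    · obtain ⟨u, rfl⟩ := hcu
      refine Ideal.mem_span_singleton'.mpr ⟨↑u⁻¹, ?_⟩
      rw [← hc, mul_comm x, ← mul_assoc, Units.inv_mul, one_mul]
    obtain ⟨d, hd | hd⟩ := ValuationRing.cond x c
    · -- `x * d = c`: then `c * c = a * d ∈ (a)`, so `c ∈ (a)`, `c = e * a`, `a = x * e * a`, `x` unit
      have hcc : c * c ∈ Ideal.span ({a} : Set A) := by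
        refine Ideal.mem_span_singleton'.mpr ⟨d, ?_⟩
        calc d * a = d * (x * c) := by rw [hc]
          _ = (x * d) * c := by ring
          _ = c * c := by rw [hd]
      obtain ⟨e, he⟩ := Ideal.mem_span_singleton'.mp (hsq c hcc)
      have h1 : a * (x * e) = a * 1 := by
        calc a * (x * e) = x * (e * a) := by ring
          _ = x * c := by rw [he]
          _ = a := hc
          _ = a * 1 := (mul_one a).symm
      have hxe : x * e = 1 := mul_left_cancel₀ ha h1
      exact absurd (isUnit_iff_exists_inv.mpr ⟨e, hxe⟩) hxu
    · -- `c * d = x`: then `x * x = a * d ∈ (a)`, so `x ∈ (a)`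
      refine hsq x (Ideal.mem_span_singleton'.mpr ⟨d, ?_⟩)
      calc d * a = d * (x * c) := by rw [hc]
        _ = x * (c * d) := by ring
        _ = x * x := by rw [hd]

/-- **A finitely generated non-zero proper radical ideal of a valuation ring is the maximal
ideal, which is then principal** (valuation rings are Bézout: finitely generated ideals are
principal, Mathlib `IsBezout.isPrincipal_of_FG`). [folklore] -/
theorem eq_maximalIdeal_of_fg_of_isRadical (I : Ideal A) (hfg : I.FG) (h0 : I ≠ ⊥) (h1 : I ≠ ⊤)
    (hrad : I.IsRadical) : I = maximalIdeal A ∧ (maximalIdeal A).IsPrincipal := by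
  haveI hP : I.IsPrincipal := IsBezout.isPrincipal_of_FG I hfg
  set a := Submodule.IsPrincipal.generator I with ha_def
  have hI : Ideal.span ({a} : Set A) = I := Ideal.span_singleton_generator I
  have ha : a ≠ 0 := by
    intro h
    apply h0
    rw [← hI, h, Ideal.span_singleton_eq_bot]
  have hu : ¬ IsUnit a := by
    intro h
    apply h1
    rw [← hI, Ideal.span_singleton_eq_top]
    exact h
  have hrad' : (Ideal.span ({a} : Set A)).IsRadical := by rwa [hI]
  have h := span_singleton_eq_maximalIdeal_of_isRadical a ha hu hrad'
  refine ⟨by rw [← hI, h], ?_⟩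
  rw [← h]
  exact ⟨a, rfl⟩

end ValuationRing

/-- **No Noetherian slicing base.** Let `O` be a valuation ring whose maximal ideal is not
principal (the value group has no least positive element; e.g. rank one and not discrete). Then
for every ring homomorphism `f : R₀ → O` from a NOETHERIAN ring `R₀` and every ideal `J` of `R₀`
whose extension `J·O` is neither `0` nor `O`, the special fibre `O ⧸ J·O` is not reduced — so it
admits no smooth factorisations over the reduced ring `R₀ ⧸ J` (in particular over a residue
field of `R₀`), and Popescu's base induction (Stacks 07F5) has no slice to start from. Proof:
`J` is finitely generated, hence so is `J·O`; were the quotient reduced, `J·O` would be a finitely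
generated radical ideal, i.e. the maximal ideal, and principal. [folklore] -/
theorem not_isReduced_quotient_map_of_not_isPrincipal
    {A : Type*} [CommRing A] [IsDomain A] [ValuationRing A]
    (h𝔪 : ¬ (IsLocalRing.maximalIdeal A).IsPrincipal)
    {R₀ : Type*} [CommRing R₀] [IsNoetherianRing R₀] (f : R₀ →+* A) (J : Ideal R₀)
    (h0 : J.map f ≠ ⊥) (h1 : J.map f ≠ ⊤) : ¬ IsReduced (A ⧸ J.map f) := by
  intro hred
  have hrad : (J.map f).IsRadical := (Ideal.isRadical_iff_quotient_reduced _).mpr hred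
  have hfg : (J.map f).FG := Ideal.FG.map (IsNoetherian.noetherian J) f
  exact h𝔪 (eq_maximalIdeal_of_fg_of_isRadical (J.map f) hfg h0 h1 hrad).2

/-- The contrapositive in positive form: if some Noetherian base `R₀ → O` has a REDUCED special
fibre `O ⧸ J·O` with `0 ≠ J·O ≠ O`, then the maximal ideal of the valuation ring `O` is principal
and equals `J·O` (so the value group has a least positive element: the top jump is discrete).
[folklore] -/
theorem maximalIdeal_isPrincipal_of_isReduced_quotient_map
    {A : Type*} [CommRing A] [IsDomain A] [ValuationRing A]
    {R₀ : Type*} [CommRing R₀] [IsNoetherianRing R₀] (f : R₀ →+* A) (J : Ideal R₀)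
    (h0 : J.map f ≠ ⊥) (h1 : J.map f ≠ ⊤) (hred : IsReduced (A ⧸ J.map f)) :
    J.map f = maximalIdeal A ∧ (maximalIdeal A).IsPrincipal :=
  eq_maximalIdeal_of_fg_of_isRadical (J.map f) (Ideal.FG.map (IsNoetherian.noetherian J) f) h0 h1
    ((Ideal.isRadical_iff_quotient_reduced _).mpr hred)

/-- **No Noetherian slicing base, for a valuation subring of a field** (the shape of the crux
`IndSmooth.ValuativeSmoothing`): if the maximal ideal of `O : ValuationSubring K` is not
principal, no ring map from a Noetherian ring to `O` has a reduced special fibre `O ⧸ J·O` with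
`0 ≠ J·O ≠ O`. [folklore] -/
theorem _root_.ValuationSubring.not_isReduced_quotient_of_noetherian_base
    {K : Type*} [Field K] (O : ValuationSubring K)
    (h𝔪 : ¬ (maximalIdeal O).IsPrincipal)
    {R₀ : Type*} [CommRing R₀] [IsNoetherianRing R₀] (f : R₀ →+* O) (J : Ideal R₀)
    (h0 : J.map f ≠ ⊥) (h1 : J.map f ≠ ⊤) : ¬ IsReduced (O ⧸ J.map f) :=
  Summit.ResolutionOfSingularities.ResolutionOfSingularities.Theorems.ValuativeSmoothing.not_isReduced_quotient_map_of_not_isPrincipal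
    h𝔪 f J h0 h1

end Summit.ResolutionOfSingularities.ResolutionOfSingularities.Theorems.ValuativeSmoothing
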